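import Literature.Geometry.Lorentzian.KerrDataSchwarzschildExtrinsic
import Literature.Geometry.Lorentzian.SchwarzschildKerrSchildComponents
import Literature.Geometry.Lorentzian.KerrHyperboloidalLeaves
import Mathlib.Analysis.SpecialFunctions.Log.Deriv
import Mathlib.Analysis.InnerProductSpace.Calculus
import HarnessLib

/-!
# The static (time-symmetric) leaf of Schwarzschild in the ingoing Kerr–Schild chart

Support file (all results proved; the definitions are explicit closed-form expressions, no
named facts). In the ingoing Kerr–Schild chart `(t*, y)` of Schwarzschild (`Kerr.bilin M 0`,
`g = η + (2M/r) ℓ ⊗ ℓ`, `ℓ = (1, y/r)`, `r = ‖y‖`) the Schwarzschild time is `t = t* − T(r)` with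
`T(r) = 2M log(r − 2M)` (`t* = v − r`, `v = t + r + 2M log(r/2M − 1)` the ingoing
Eddington–Finkelstein time, up to an additive constant), so the **static slice** `{t = 0}` of the
exterior is the graph `t* = T(r)` over `{r > 2M}`:

* `Kerr.staticHeight M r = 2M log(r − 2M)`, slope `T′ = 2M/(r − 2M)` (`hasDerivAt_staticHeight`);
  `Kerr.staticLeaf M r₁ = Kerr.leafEmbed 0 r₁ (T ∘ ‖·‖) 0 : Kerr.slice 0 r₁ → Kerr.region 0 r₁`
  (used for `2M ≤ r₁`), with differential `dψ_y v = (T′ ⟪y, v⟫/r, v)` (`hasMFDerivAt_staticLeaf`);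
* **the induced metric is the Schwarzschild `t = const` metric in Cartesian form**,
  `ψ^* g = δ + (2M/(r²(r − 2M))) ⟪y, ·⟫ ⊗ ⟪y, ·⟫` (`= (1 − 2M/r)⁻¹ dr² + r² dΩ²`;
  `Kerr.staticHRep`, `bilin_staticLeafDeriv`), so `ψ` is a spacelike immersion
  (`isSpacelikeImmersion_staticLeaf`), and it is injective;
* **the future unit normal is the normalised static Killing field**,
  `N = (1 − 2M/r)^{-1/2} ∂_{t*}` (`Kerr.staticNormalRep`; `bilin_basisVector_staticLeafDeriv`:
  `g(∂_{t*}, dψ v) = 0`, `isFutureUnitNormal_staticNormal`);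
* **the leaf is totally geodesic**: `K_N = 0` (`secondFundamentalForm_staticLeaf`) — time
  symmetry of the static slice, here by the coordinate formula
  `K_N(v, w) = g(DN v + Γ(N)(dψ v), dψ w)` (`OpensChart.secondFundamentalForm_eq_of_repr`) with
  `DN v ∥ ∂_{t*} ⊥ dψ w`, `∂_{∂_{t*}} g = 0` (stationarity of the Kerr–Schild components) and the
  symmetry in `(v, w)` of `(∂_{dψ v} g)(∂_{t*}, dψ w)`.

This is the `a = 0`, un-rescaled half of the statement that the Boyer–Lindquist slice of Kerr is
an exact spacelike Kerr leaf with Dafermos–Rodnianski admissible asymptotics (the isotropic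
rescaling `r = ρ(1 + M/2ρ)²`, under which `ψ^* g = (1 + M/2ρ)⁴ δ`, is the sequel
`SchwarzschildIsotropicLeaf.lean`). Wald 1984, §6.4 (ingoing Eddington–Finkelstein coordinates,
`v = t + r*`, `r* = r + 2M log(r/2M − 1)`) and §10.2 (time-symmetric data of static slices);
Cook, Living Rev. Relativ. 3 (2000) 5, §3.2.2 (Kerr–Schild form, lapse and shift);
Dafermos–Rodnianski arXiv:0811.0354, §5.1 (the chart `(t*, y)`).
-/

noncomputable section

-- instance search through the nested operator types `E4 →L E4 →L E4 →L ℝ` (as in `ChartCurvature`)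
set_option maxSynthPendingDepth 3

open Bundle TopologicalSpace Manifold Set Module
open scoped ContDiff Topology InnerProductSpace

namespace Literature.Geometry.Lorentzian

namespace Kerr

/-! ### The static height and its slope -/

/-- **The static height** `T(r) = 2M log(r − 2M)`: in the ingoing Kerr–Schild chart the
Schwarzschild static slices `{t = const}` of the exterior are the graphs `t* = T(r) + const`
(`t* = v − r`, `v = t + r + 2M log(r/2M − 1)`). Junk (but harmless) values for `r ≤ 2M`.
Wald 1984, §6.4. [cite: Wald1984, §6.4] -/
def staticHeight (M r : ℝ) : ℝ :=
  2 * M * Real.log (r - 2 * M)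

/-- **The slope of the static height**: `T′(r) = 2M/(r − 2M)` for `r > 2M`
(`= 2Mr/Δ`, `Δ = r² − 2Mr`, the `a = 0` Boyer–Lindquist slope). [cite: Wald1984, §6.4] -/
theorem hasDerivAt_staticHeight (M : ℝ) {r : ℝ} (hr : 2 * M < r) :
    HasDerivAt (staticHeight M) (2 * M / (r - 2 * M)) r := by
  have h0 : r - 2 * M ≠ 0 := (sub_pos.2 hr).ne'
  have h1 : HasDerivAt (fun r : ℝ ↦ r - 2 * M) 1 r := (hasDerivAt_id r).sub_const (2 * M)
  have h2 : HasDerivAt (fun r : ℝ ↦ 2 * M * Real.log (r - 2 * M)) (2 * M * (1 / (r - 2 * M))) r :=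
    (h1.log h0).const_mul (2 * M)
  rw [mul_one_div] at h2
  exact h2

/-- The static height is `C^∞` on `r > 2M`. [cite: Wald1984, §6.4] -/
theorem contDiffAt_staticHeight (M : ℝ) {r : ℝ} (hr : 2 * M < r) {n : WithTop ℕ∞} :
    ContDiffAt ℝ n (staticHeight M) r := by
  have h0 : r - 2 * M ≠ 0 := (sub_pos.2 hr).ne'
  unfold staticHeight
  exact contDiffAt_const.mul
    ((Real.contDiffAt_log.2 h0).comp r (contDiffAt_id.sub contDiffAt_const))

/-- The static height as a function of the Kerr–Schild slice coordinates (`a = 0`, `r = ‖y‖`):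
`h(y) = T(‖y‖)`. [cite: Wald1984, §6.4] -/
def staticHeightFun (M : ℝ) (y : E3) : ℝ :=
  staticHeight M ‖y‖

/-- The radial slope coefficient `T′(r)/r = 2M/(r(r − 2M))`, so that `dh_y = (T′/r) ⟪y, ·⟫`.
[cite: Wald1984, §6.4] -/
def staticSlope (M r : ℝ) : ℝ :=
  2 * M / (r * (r - 2 * M))

/-- **`dh_y = (2M/(r(r − 2M))) ⟪y, ·⟫`** for `‖y‖ > max (2M) 0` (chain rule with
`D‖·‖ = ⟪y, ·⟫/‖y‖`). [cite: Wald1984, §6.4] -/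
theorem hasFDerivAt_staticHeightFun (M : ℝ) {y : E3} (hy : 2 * M < ‖y‖) (hy0 : y ≠ 0) :
    HasFDerivAt (staticHeightFun M) (staticSlope M ‖y‖ • E3.covec y) y := by
  have hr : ‖y‖ ≠ 0 := norm_ne_zero_iff.2 hy0
  have h := (hasDerivAt_staticHeight M hy).comp_hasFDerivAt y (hasFDerivAt_norm_E3 hy0)
  unfold staticHeightFun
  refine h.congr_fderiv ?_
  rw [smul_smul, staticSlope]
  congr 1
  field_simp

/-- The static height is `C^∞` at the points `‖y‖ > 2M`, `y ≠ 0`. [cite: Wald1984, §6.4] -/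
theorem contDiffAt_staticHeightFun (M : ℝ) {y : E3} (hy : 2 * M < ‖y‖) (hy0 : y ≠ 0)
    {n : WithTop ℕ∞} : ContDiffAt ℝ n (staticHeightFun M) y :=
  (contDiffAt_staticHeight M hy).comp y (contDiffAt_norm ℝ hy0)

/-! ### The static leaf, its differential, the induced metric -/

/-- **The static leaf** `y ↦ (T(‖y‖), y)` of the Schwarzschild Kerr–Schild chart over the slice
`{‖y‖ > max r₁ 0}` (meant for `2M ≤ r₁`: the static slice `{t = 0}` of the exterior), as a leaf
embedding of `KerrHyperboloidalLeaves.lean`. Wald 1984, §6.4 and §10.2.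
[cite: Wald1984, §6.4] -/
def staticLeaf (M r₁ : ℝ) : slice 0 r₁ → region 0 r₁ :=
  leafEmbed 0 r₁ (staticHeightFun M) 0

/-- The representative `Φ(y) = (T(‖y‖), y)` of the static leaf on all of `E3`. [cite: Wald1984, §6.4] -/
def staticLeafRep (M : ℝ) (y : E3) : E4 :=
  E4.ofTimeSpace (staticHeightFun M y) y

/-- `staticLeaf M r₁ y = (T(‖y‖), y)`. [cite: Wald1984, §6.4] -/
@[simp]
theorem coe_staticLeaf (M r₁ : ℝ) (y : slice 0 r₁) :
    (staticLeaf M r₁ y : E4) = staticLeafRep M y := by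
  rw [staticLeaf, coe_leafEmbed, zero_add, staticLeafRep]

/-- The spatial part of the static leaf point over `y` is `y`. [cite: Wald1984, §6.4] -/
@[simp]
theorem spatial_staticLeafRep (M : ℝ) (y : E3) : E4.spatial (staticLeafRep M y) = y := by
  rw [staticLeafRep, E4.spatial_ofTimeSpace]

/-- The static leaf is injective (its spatial part is the identity). [cite: Wald1984, §6.4] -/
theorem staticLeaf_injective (M r₁ : ℝ) : Function.Injective (staticLeaf M r₁) := by
  intro y y' h
  have h' := congrArg (fun x : region 0 r₁ ↦ E4.spatial (x : E4)) h
  simp only [coe_staticLeaf, spatial_staticLeafRep] at h'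
  exact Subtype.ext h'

/-- **The differential of the static leaf** as a continuous linear map:
`v ↦ (T′/r) ⟪y, v⟫ ∂_{t*} + (0, v)`. [cite: Wald1984, §6.4] -/
def staticLeafDeriv (M : ℝ) (y : E3) : E3 →L[ℝ] E4 :=
  (staticSlope M ‖y‖ • E3.covec y).smulRight (E4.basisVector 0) + E4.spaceEmbed

/-- `dΦ_y v = ((2M/(r(r − 2M))) ⟪y, v⟫, v)`. [cite: Wald1984, §6.4] -/
@[simp]
theorem staticLeafDeriv_apply (M : ℝ) (y v : E3) :
    staticLeafDeriv M y v = E4.ofTimeSpace (staticSlope M ‖y‖ * ⟪y, v⟫_ℝ) v := by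
  rw [staticLeafDeriv, E4.smulRight_add_spaceEmbed_apply]
  simp

/-- The representative is differentiable with derivative `staticLeafDeriv`, at `‖y‖ > 2M`,
`y ≠ 0`. [cite: Wald1984, §6.4] -/
theorem hasFDerivAt_staticLeafRep (M : ℝ) {y : E3} (hy : 2 * M < ‖y‖) (hy0 : y ≠ 0) :
    HasFDerivAt (staticLeafRep M) (staticLeafDeriv M y) y := by
  have h := E4.hasFDerivAt_graphMap (hasFDerivAt_staticHeightFun M hy hy0) 0
  simp only [zero_add] at h
  exact h

variable {M r₁ : ℝ}

/-- Points of the slice `{‖y‖ > max r₁ 0}` with `2M ≤ r₁` have `‖y‖ > 2M`. [folklore] -/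
theorem two_mul_lt_norm_of_slice (hr₁ : 2 * M ≤ r₁) (y : slice 0 r₁) : 2 * M < ‖(y : E3)‖ :=
  (hr₁.trans (le_max_left _ _)).trans_lt (mem_slice_zero_iff.1 y.2)

/-- **The differential of the static leaf**: `dψ_y = staticLeafDeriv M y`. [cite: Wald1984, §6.4] -/
theorem hasMFDerivAt_staticLeaf (hr₁ : 2 * M ≤ r₁) (y : slice 0 r₁) :
    HasMFDerivAt 𝓘(ℝ, E3) 𝓘(ℝ, E4) (staticLeaf M r₁) y (staticLeafDeriv M y) :=
  hasMFDerivAt_leafEmbed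
    (hasFDerivAt_staticHeightFun M (two_mul_lt_norm_of_slice hr₁ y) (ne_zero_of_mem_slice_zero y))

/-- `mfderiv` form of `hasMFDerivAt_staticLeaf`. [cite: Wald1984, §6.4] -/
theorem mfderiv_staticLeaf_apply (hr₁ : 2 * M ≤ r₁) (y : slice 0 r₁) (v : E3) :
    mfderiv 𝓘(ℝ, E3) 𝓘(ℝ, E4) (staticLeaf M r₁) y v =
      E4.ofTimeSpace (staticSlope M ‖(y : E3)‖ * ⟪(y : E3), v⟫_ℝ) v := by
  rw [(hasMFDerivAt_staticLeaf hr₁ y).mfderiv]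
  exact staticLeafDeriv_apply M y v

/-- The static leaf is `C^∞`. [cite: Wald1984, §6.4] -/
theorem contMDiff_staticLeaf (hr₁ : 2 * M ≤ r₁) :
    ContMDiff 𝓘(ℝ, E3) 𝓘(ℝ, E4) ∞ (staticLeaf M r₁) :=
  contMDiff_leafEmbed fun y ↦
    contDiffAt_staticHeightFun M (two_mul_lt_norm_of_slice hr₁ y) (ne_zero_of_mem_slice_zero y)

/-- **The Schwarzschild static-slice metric in Kerr–Schild Cartesian coordinates**, as a
function on `E3`: `staticHRep M y = δ + (2M/(r²(r − 2M))) ⟪y, ·⟫ ⊗ ⟪y, ·⟫`, i.e.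
`(1 − 2M/r)⁻¹ dr² + r² dΩ²` (`dr = ⟪y, ·⟫/r`): the Schwarzschild metric (Wald 1984, §6.1) at `t = const`.
[cite: Wald1984, §6.4] -/
def staticHRep (M : ℝ) (y : E3) : E3 →L[ℝ] E3 →L[ℝ] ℝ :=
  E3.delta + (2 * M / (‖y‖ ^ 2 * (‖y‖ - 2 * M))) • (E3.covec y).smulRight (E3.covec y)

/-- `staticHRep M y v w = ⟪v, w⟫ + (2M/(r²(r − 2M))) ⟪y, v⟫ ⟪y, w⟫`. [cite: Wald1984, §6.4] -/
@[simp]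
theorem staticHRep_apply (M : ℝ) (y v w : E3) :
    staticHRep M y v w = ⟪v, w⟫_ℝ + 2 * M / (‖y‖ ^ 2 * (‖y‖ - 2 * M)) * (⟪y, v⟫_ℝ * ⟪y, w⟫_ℝ) := by
  simp [staticHRep, ContinuousLinearMap.smulRight_apply]

/-- **The induced metric of the static leaf**: for `‖y‖ > 2M`, `y ≠ 0`,
`g_{Φ y}(dΦ v, dΦ w) = ⟪v, w⟫ + (2M/(r²(r − 2M))) ⟪y, v⟫⟪y, w⟫` — the Schwarzschild `t = const`
metric `(1 − 2M/r)⁻¹ dr² + r² dΩ²`. Wald 1984, §6.1 and §6.4; Cook 2000, §3.2.2 (Kerr–Schild form).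
[cite: Wald1984, §6.4] -/
theorem bilin_staticLeafDeriv (M : ℝ) {y : E3} (hy : 2 * M < ‖y‖) (hy0 : y ≠ 0) (v w : E3) :
    bilin M 0 (staticLeafRep M y) (staticLeafDeriv M y v) (staticLeafDeriv M y w) =
      staticHRep M y v w := by
  have hr : ‖y‖ ≠ 0 := norm_ne_zero_iff.2 hy0
  have hr2 : ‖y‖ - 2 * M ≠ 0 := (sub_pos.2 hy).ne'
  have hsp : E4.spatial (staticLeafRep M y) ≠ 0 := by rwa [spatial_staticLeafRep]
  rw [bilin_zero_eq_bilinZero M hsp, bilinZero_apply]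
  simp only [minkowski_bilin_eq_spatial, staticLeafDeriv_apply, nullCovectorZero_apply,
    spatial_staticLeafRep, E4.spatial_ofTimeSpace, E4.ofTimeSpace_apply_zero, staticHRep_apply,
    staticSlope]
  field_simp
  ring

/-- The induced form of the static leaf is positive definite for `0 ≤ M`, `‖y‖ > 2M` (`δ` plus a
nonnegative rank-one form). O'Neill 1983, Ch. 4, p. 97. [cite: ONeill1983, Ch. 4, p. 97] -/
theorem staticHRep_pos {M : ℝ} (hM : 0 ≤ M) {y : E3} (hy : 2 * M < ‖y‖) {v : E3} (hv : v ≠ 0) :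
    0 < staticHRep M y v v := by
  rw [staticHRep_apply]
  have h1 : 0 < ⟪v, v⟫_ℝ := real_inner_self_pos.2 hv
  have h2 : 0 ≤ 2 * M / (‖y‖ ^ 2 * (‖y‖ - 2 * M)) * (⟪y, v⟫_ℝ * ⟪y, v⟫_ℝ) := by
    have : 0 < ‖y‖ - 2 * M := sub_pos.2 hy
    have : 0 ≤ ⟪y, v⟫_ℝ * ⟪y, v⟫_ℝ := mul_self_nonneg _
    positivity
  linarith

/-- **The static leaf is a spacelike immersion** `Kerr.slice 0 r₁ → (Kerr.region 0 r₁, g_{M,0})`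
for `0 ≤ M`, `2M ≤ r₁`. O'Neill 1983, Ch. 4, p. 97; Wald 1984, §10.2. [cite: Wald1984, §10.2] -/
theorem isSpacelikeImmersion_staticLeaf [Facts] (hM : 0 ≤ M) (hr₁ : 2 * M ≤ r₁) :
    (smoothMetric M 0 r₁).IsSpacelikeImmersion 𝓘(ℝ, E3) (staticLeaf M r₁) := by
  refine ⟨contMDiff_staticLeaf hr₁, fun y v hv ↦ ?_⟩
  have hy := two_mul_lt_norm_of_slice hr₁ y
  have hy0 := ne_zero_of_mem_slice_zero y
  set w : E3 := v with hw
  have hw0 : w ≠ 0 := hv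
  have hgoal : 0 < bilin M 0 (staticLeafRep M y) (staticLeafDeriv M y w) (staticLeafDeriv M y w) := by
    rw [bilin_staticLeafDeriv M hy hy0]
    exact staticHRep_pos hM hy hw0
  rw [PseudoRiemannianMetric.inducedBilin_apply, (hasMFDerivAt_staticLeaf hr₁ y).mfderiv,
    smoothMetric_val, coe_staticLeaf]
  exact hgoal

/-! ### The future unit normal: the normalised static Killing field -/

/-- **The future unit normal of the static leaf** as a function on `E3`:
`N(y) = (1 − 2M/‖y‖)^{-1/2} ∂_{t*}` (the normalised static Killing field `∂_t = ∂_{t*}`).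
Wald 1984, §6.1 (static observers) and §10.2. [cite: Wald1984, §10.2] -/
def staticNormalRep (M : ℝ) (y : E3) : E4 :=
  (√(1 - 2 * M / ‖y‖))⁻¹ • E4.basisVector 0

/-- The future unit normal of the static leaf as a field along it. [cite: Wald1984, §10.2] -/
def staticNormal (M r₁ : ℝ) : NormalField 𝓘(ℝ, E4) (staticLeaf M r₁) :=
  fun y ↦ staticNormalRep M y

/-- Unfolding lemma. [cite: Wald1984, §10.2] -/
theorem staticNormal_apply (M r₁ : ℝ) (y : slice 0 r₁) : staticNormal M r₁ y = staticNormalRep M y :=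
  rfl

/-- `1 − 2M/r > 0` for `r > max (2M) 0`. [folklore] -/
theorem one_sub_pos {M r : ℝ} (hr : 2 * M < r) (hr0 : 0 < r) : 0 < 1 - 2 * M / r := by
  rw [sub_pos, div_lt_one hr0]
  exact hr

/-- **`∂_{t*}` is normal to the static leaf**: `g_{Φ y}(∂_{t*}, dΦ w) = 0` for `‖y‖ > 2M`, `y ≠ 0`
(`T′ = 2H(1 + T′)`, `H = M/r`). Wald 1984, §6.1 (hypersurface orthogonality of the static Killing
field). [cite: Wald1984, §10.2] -/
theorem bilin_basisVector_staticLeafDeriv (M : ℝ) {y : E3} (hy : 2 * M < ‖y‖) (hy0 : y ≠ 0)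
    (w : E3) :
    bilin M 0 (staticLeafRep M y) (E4.basisVector 0) (staticLeafDeriv M y w) = 0 := by
  have hr : ‖y‖ ≠ 0 := norm_ne_zero_iff.2 hy0
  have hr2 : ‖y‖ - 2 * M ≠ 0 := (sub_pos.2 hy).ne'
  have hsp : E4.spatial (staticLeafRep M y) ≠ 0 := by rwa [spatial_staticLeafRep]
  rw [bilin_zero_eq_bilinZero M hsp, bilinZero_apply]
  simp only [minkowski_bilin_eq_spatial, staticLeafDeriv_apply, nullCovectorZero_apply,
    spatial_staticLeafRep, E4.spatial_ofTimeSpace, E4.ofTimeSpace_apply_zero,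
    spatial_basisVector_zero, basisVector_zero_apply_zero, inner_zero_right, inner_zero_left,
    staticSlope]
  field_simp
  ring

/-- `g_{Φ y}(∂_{t*}, ∂_{t*}) = −(1 − 2M/r)`. [cite: Wald1984, §6.1] -/
theorem bilin_basisVector_basisVector (M : ℝ) {y : E3} (hy0 : y ≠ 0) :
    bilin M 0 (staticLeafRep M y) (E4.basisVector 0) (E4.basisVector 0) = -(1 - 2 * M / ‖y‖) := by
  have hsp : E4.spatial (staticLeafRep M y) ≠ 0 := by rwa [spatial_staticLeafRep]
  rw [bilin_zero_eq_bilinZero M hsp, bilinZero_apply]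
  simp only [minkowski_bilin_eq_spatial, nullCovectorZero_apply, spatial_staticLeafRep,
    spatial_basisVector_zero, basisVector_zero_apply_zero, inner_zero_right]
  ring

/-- **Normality**: `g(N, dΦ w) = 0`. [cite: Wald1984, §10.2] -/
theorem bilin_staticNormalRep_staticLeafDeriv (M : ℝ) {y : E3} (hy : 2 * M < ‖y‖) (hy0 : y ≠ 0)
    (w : E3) :
    bilin M 0 (staticLeafRep M y) (staticNormalRep M y) (staticLeafDeriv M y w) = 0 := by
  rw [staticNormalRep, map_smul, smul_apply,
    bilin_basisVector_staticLeafDeriv M hy hy0 w, smul_zero]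

/-- **Unit**: `g(N, N) = −1` for `‖y‖ > max (2M) 0`. [cite: Wald1984, §10.2] -/
theorem bilin_staticNormalRep_self (M : ℝ) {y : E3} (hy : 2 * M < ‖y‖) (hy0 : y ≠ 0) :
    bilin M 0 (staticLeafRep M y) (staticNormalRep M y) (staticNormalRep M y) = -1 := by
  have hq := one_sub_pos hy (norm_pos_iff.2 hy0)
  have hs : (√(1 - 2 * M / ‖y‖)) ^ 2 = 1 - 2 * M / ‖y‖ := Real.sq_sqrt hq.le
  have key : (√(1 - 2 * M / ‖y‖))⁻¹ * ((√(1 - 2 * M / ‖y‖))⁻¹ * -(1 - 2 * M / ‖y‖)) = -1 := by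
    rw [← mul_assoc, ← pow_two, inv_pow, hs, mul_neg, inv_mul_cancel₀ hq.ne']
  simp only [staticNormalRep, map_smul, smul_apply, smul_eq_mul,
    bilin_basisVector_basisVector M hy0]
  exact key

/-- **Future**: `g(V, N) = −(1 − 2M/r)^{-1/2} < 0` for the orienting field `V = −g♯dt*`.
[cite: arXiv08110354, §5.1] -/
theorem bilin_timeVector_staticNormalRep_neg (M : ℝ) {y : E3} (hy : 2 * M < ‖y‖) (hy0 : y ≠ 0) :
    bilin M 0 (staticLeafRep M y) (timeVector M 0 (staticLeafRep M y)) (staticNormalRep M y) < 0 := by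
  have hq := one_sub_pos hy (norm_pos_iff.2 hy0)
  have hx : 0 < radius 0 (staticLeafRep M y) := by
    rw [radius_zero_eq_norm_spatial, spatial_staticLeafRep]; exact norm_pos_iff.2 hy0
  rw [bilin_timeVector hx, staticNormalRep]
  simp only [PiLp.smul_apply, smul_eq_mul, basisVector_zero_apply_zero, mul_one, neg_lt_zero,
    inv_pos]
  exact Real.sqrt_pos.2 hq

/-- **`N` is the future unit normal of the static leaf** for the Kerr time orientation
(`0 ≤ M`, `2M ≤ r₁`). Wald 1984, §10.2. [cite: Wald1984, §10.2] -/
theorem isFutureUnitNormal_staticNormal [Facts] (hM : 0 ≤ M) (hr₁ : 2 * M ≤ r₁) :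
    (smoothMetric M 0 r₁).IsFutureUnitNormal 𝓘(ℝ, E3) ((timeOrientation M 0 r₁ hM).ofLE le_top)
      (staticLeaf M r₁) (staticNormal M r₁) := by
  refine ⟨⟨fun y v ↦ ?_, fun y ↦ ?_⟩, fun y ↦ ⟨⟨?_, ?_⟩, ?_⟩⟩
  · have hy := two_mul_lt_norm_of_slice hr₁ y
    have hy0 := ne_zero_of_mem_slice_zero y
    set w : E3 := v with hw
    have hgoal : bilin M 0 (staticLeafRep M y) (staticNormalRep M y) (staticLeafDeriv M y w) = 0 :=
      bilin_staticNormalRep_staticLeafDeriv M hy hy0 w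
    rw [smoothMetric_val, (hasMFDerivAt_staticLeaf hr₁ y).mfderiv, coe_staticLeaf]
    exact hgoal
  · have hgoal : bilin M 0 (staticLeafRep M y) (staticNormalRep M y) (staticNormalRep M y) = -1 :=
      bilin_staticNormalRep_self M (two_mul_lt_norm_of_slice hr₁ y) (ne_zero_of_mem_slice_zero y)
    rw [smoothMetric_val, coe_staticLeaf]
    exact hgoal
  · have hgoal : bilin M 0 (staticLeafRep M y) (staticNormalRep M y) (staticNormalRep M y) ≤ 0 := by
      rw [bilin_staticNormalRep_self M (two_mul_lt_norm_of_slice hr₁ y) (ne_zero_of_mem_slice_zero y)]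
      norm_num
    rw [smoothMetric_val, coe_staticLeaf]
    exact hgoal
  · intro h0
    have h1 := bilin_staticNormalRep_self M (two_mul_lt_norm_of_slice hr₁ y)
      (ne_zero_of_mem_slice_zero y)
    rw [show staticNormalRep M y = (0 : E4) from h0] at h1
    simp at h1
  · have hgoal : bilin M 0 (staticLeafRep M y) (timeVector M 0 (staticLeafRep M y))
        (staticNormalRep M y) < 0 :=
      bilin_timeVector_staticNormalRep_neg M (two_mul_lt_norm_of_slice hr₁ y)
        (ne_zero_of_mem_slice_zero y)
    rw [TimeOrientation.vectorField_ofLE, smoothMetric_val, coe_staticLeaf]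
    exact hgoal

/-- `N` is differentiable at the points `‖y‖ > max (2M) 0`. [folklore] -/
theorem differentiableAt_staticNormalRep (M : ℝ) {y : E3} (hy : 2 * M < ‖y‖) (hy0 : y ≠ 0) :
    DifferentiableAt ℝ (staticNormalRep M) y := by
  have hq := one_sub_pos hy (norm_pos_iff.2 hy0)
  have hn : ContDiffAt ℝ 1 (fun y : E3 ↦ ‖y‖) y := contDiffAt_norm ℝ hy0
  have h1 : ContDiffAt ℝ 1 (fun y : E3 ↦ 1 - 2 * M / ‖y‖) y :=
    contDiffAt_const.sub ((contDiffAt_const.div hn (norm_ne_zero_iff.2 hy0)))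
  have h2 : ContDiffAt ℝ 1 (fun y : E3 ↦ (√(1 - 2 * M / ‖y‖))⁻¹) y :=
    (h1.sqrt hq.ne').inv (Real.sqrt_pos.2 hq).ne'
  exact (h2.smul contDiffAt_const).differentiableAt one_ne_zero

/-- The derivative of `N = f ∂_{t*}` is `(df v) ∂_{t*}`: it is proportional to `∂_{t*}`.
[folklore] -/
theorem fderiv_staticNormalRep (M : ℝ) {y : E3} (hy : 2 * M < ‖y‖) (hy0 : y ≠ 0) (v : E3) :
    fderiv ℝ (staticNormalRep M) y v =
      fderiv ℝ (fun y : E3 ↦ (√(1 - 2 * M / ‖y‖))⁻¹) y v • E4.basisVector 0 := by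
  have hq := one_sub_pos hy (norm_pos_iff.2 hy0)
  have hn : ContDiffAt ℝ 1 (fun y : E3 ↦ ‖y‖) y := contDiffAt_norm ℝ hy0
  have h1 : ContDiffAt ℝ 1 (fun y : E3 ↦ 1 - 2 * M / ‖y‖) y :=
    contDiffAt_const.sub ((contDiffAt_const.div hn (norm_ne_zero_iff.2 hy0)))
  have h2 : DifferentiableAt ℝ (fun y : E3 ↦ (√(1 - 2 * M / ‖y‖))⁻¹) y :=
    ((h1.sqrt hq.ne').inv (Real.sqrt_pos.2 hq).ne').differentiableAt one_ne_zero
  have : staticNormalRep M = fun y ↦ (√(1 - 2 * M / ‖y‖))⁻¹ • E4.basisVector 0 := rfl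
  rw [this, fderiv_smul_const h2]
  simp

/-! ### Time symmetry: the static leaf is totally geodesic -/

/-- **Stationarity**: the Kerr–Schild components do not depend on `t*`,
`(∂_{∂_{t*}} g)(A, B) = 0` off the axis. [cite: Cook2000, §3.2.2] -/
theorem bilinZeroDeriv_basisVector (M : ℝ) (x A B : E4) :
    bilinZeroDeriv M x (E4.basisVector 0) A B = 0 := by
  simp [bilinZeroDeriv_apply, nullCovectorZeroDeriv_apply, spatial_basisVector_zero]

/-- **The static leaf is totally geodesic: `K_N = 0`.** The second fundamental form of the static
leaf w.r.t. its future unit normal vanishes identically (for every `M` and every `r₁ ≥ 2M`): in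
the coordinate formula `K_N(v, w) = g(DN v + Γ(N)(dΦ v), dΦ w)` the first term
vanishes because `DN v ∥ ∂_{t*} ⊥ dΦ w`, and `2 g(Γ(N)(dΦ v), dΦ w) = (∂_{dΦ v} g)(N, dΦ w) +
(∂_N g)(dΦ w, dΦ v) − (∂_{dΦ w} g)(dΦ v, N)` vanishes by stationarity (middle term) and the
symmetry of `(∂_{dΦ v} g)(∂_{t*}, dΦ w)` in `(v, w)`. This is the time symmetry of the static
slices of Schwarzschild. Wald 1984, §10.2 (time-symmetric initial data, `K_{ab} = 0`);
O'Neill 1983, Ch. 4, Lemma 4.4 ff. [cite: Wald1984, §10.2] -/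
theorem secondFundamentalForm_staticLeaf [Facts] [(smoothMetric M 0 r₁).HasLeviCivita]
    (hr₁ : 2 * M ≤ r₁) (y : slice 0 r₁) (v w : E3) :
    (smoothMetric M 0 r₁).secondFundamentalForm 𝓘(ℝ, E3) (staticLeaf M r₁) (staticNormal M r₁)
      y v w = 0 := by
  have hy := two_mul_lt_norm_of_slice hr₁ y
  have hy0 : (y : E3) ≠ 0 := ne_zero_of_mem_slice_zero y
  have hr : ‖(y : E3)‖ ≠ 0 := norm_ne_zero_iff.2 hy0
  have hr2 : ‖(y : E3)‖ - 2 * M ≠ 0 := (sub_pos.2 hy).ne'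
  have hsp : E4.spatial (staticLeafRep M y) ≠ 0 := by rwa [spatial_staticLeafRep]
  have hGd : DifferentiableAt ℝ (bilin M 0) (staticLeaf M r₁ y : E4) := by
    rw [coe_staticLeaf]; exact (hasFDerivAt_bilin_zero M hsp).differentiableAt
  rw [OpensChart.secondFundamentalForm_eq_of_repr (g := (smoothMetric M 0 r₁).toPseudoRiemannianMetric)
    (G := bilin M 0) (smoothMetric_val M 0 r₁) (f := staticLeaf M r₁) (Φ := staticLeafRep M)
    (coe_staticLeaf M r₁) (staticNormal_apply M r₁) (hasFDerivAt_staticLeafRep M hy hy0).differentiableAt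
    (differentiableAt_staticNormalRep M hy hy0) hGd v w,
    (hasFDerivAt_staticLeafRep M hy hy0).fderiv]
  -- the Christoffel symbols of the first kind: `g(Γ(N)(Ṽ), W̃) = ½ K(N, Ṽ, W̃)`
  have hΓ := OpensChart.val_christoffel_const (g := (smoothMetric M 0 r₁).toPseudoRiemannianMetric)
    (G := bilin M 0) (staticLeaf M r₁ y) (staticNormalRep M y) (staticLeafDeriv M y v)
    (staticLeafDeriv M y w)
  have hΓ' : bilin M 0 (staticLeafRep M y) (OpensChart.christoffel
      (smoothMetric M 0 r₁).toPseudoRiemannianMetric (bilin M 0) (staticLeaf M r₁ y)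
      (staticNormalRep M y) (staticLeafDeriv M y v)) (staticLeafDeriv M y w) =
      2⁻¹ * OpensChart.koszulForm (bilin M 0) (staticLeafRep M y) (staticNormalRep M y)
        (staticLeafDeriv M y v) (staticLeafDeriv M y w) := by
    rw [← coe_staticLeaf]; exact hΓ
  show bilin M 0 (staticLeafRep M y) (fderiv ℝ (staticNormalRep M) y v + OpensChart.christoffel
      (smoothMetric M 0 r₁).toPseudoRiemannianMetric (bilin M 0) (staticLeaf M r₁ y)
      (staticNormalRep M y) (staticLeafDeriv M y v)) (staticLeafDeriv M y w) = 0
  rw [map_add, add_apply, hΓ', OpensChart.koszulForm_apply, fderiv_staticNormalRep M hy hy0 v,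
    map_smul, smul_apply, bilin_basisVector_staticLeafDeriv M hy hy0 w, smul_zero,
    zero_add, fderiv_bilin_zero_apply M hsp, fderiv_bilin_zero_apply M hsp,
    fderiv_bilin_zero_apply M hsp]
  have h3 : ⟪w, v⟫_ℝ = ⟪v, w⟫_ℝ := real_inner_comm _ _
  simp only [bilinZeroDeriv_apply, nullCovectorZero_apply, nullCovectorZeroDeriv_apply,
    spatial_staticLeafRep, staticLeafDeriv_apply, E4.spatial_ofTimeSpace, E4.ofTimeSpace_apply_zero,
    staticNormalRep, map_smul, smul_apply, smul_eq_mul,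
    spatial_basisVector_zero, basisVector_zero_apply_zero, inner_zero_right, inner_zero_left]
  simp only [h3]
  ring

end Kerr

end Literature.Geometry.Lorentzian

end
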